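import Mathlib
import HarnessLib
import Summits.CriticalPhenomena.SAWScalingLimit.Theorems.SAWSpinMonotoneQCIdentificationDefs

/-!
# Bulk-sum regrouping over the ports of a hexagonal domain (helper L6a, line `eight_fifths_primitive`)

Helper sub-goal L6a of the stubs `stub_subsequentialLimits` / `stub_rayCondition` of line
`eight_fifths_primitive`, crux `QCIdentification` (stmt-CriticalPhenomena-16772).

**What.** The `ψ`-averaged observable of the target,
`bulkAverage Λ a ψ δ = δ² Σᶠ_{e ∈ Ω_δ} ψ(δ m_e) F_δ(e)` (vocabulary module
`SAWSpinMonotoneQCIdentificationDefs`), is a `finsum` over the SET `hexDomainMidEdges (Λ δ)` of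
mid-edges with at least one endpoint in `Λ δ`. Every analytic step of the line (the PL dictionary
`∂h = modeSum / …` on the triangle `Δ_v`, the `∂H`-mode `modeSum F v = F(p₀) + F(p₁) + F(p₂)`) is a
VERTEX-BY-VERTEX sum over the three ports `p_k = {v, hexNbr v k}` of `v ∈ Λ`. This file proves the
exact regrouping identity (double counting of the darts `(v, k)`, `v ∈ Λ`, over their mid-edges):

  `Σᶠ_{e ∈ Ω(Λ)} g e = Σ_{v ∈ Λ} Σ_{k : Fin 3} portWeight Λ v k · g {v, hexNbr v k}`
  (`bulk_finsum_midEdges_eq`), where `portWeight Λ v k = 1/2` if the far endpoint `hexNbr v k` lies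
  in `Λ` (an interior mid-edge is a port of BOTH of its endpoints) and `= 1` otherwise (a boundary
  mid-edge is a port of its unique endpoint in `Λ`);

and its corollary for the averaged observable (`bulk_bulkAverage_eq`):

  `bulkAverage Λ a ψ δ = δ² Σ_{v ∈ Λ δ} Σ_k portWeight (Λ δ) v k · ψ(δ m_{p_k}) F_δ(p_k)`.

**How.** `hexDomainMidEdges Λ` is the image `portEdges Λ` of the finite set of darts `Λ × Fin 3`
under `(v, k) ↦ {v, hexNbr v k}` (`coe_portEdges`; in particular it is finite and the `finsum` is a
`Finset.sum`, `finsum_mem_hexDomainMidEdges_eq`). Expanding every dart term as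
`Σ_{e ∈ portEdges Λ} [p_k(v) = e] · portWeight · g e` and exchanging the sums, the identity reduces
to the fibre count `Σ_{v ∈ Λ} Σ_k [{v, hexNbr v k} = e] · portWeight Λ v k = 1` for every mid-edge
`e = {x, y}` of the domain (`sum_fibreWeight_eq_one`): the darts over `e` are `(x, k_x)` (if
`x ∈ Λ`) and `(y, k_y)` (if `y ∈ Λ`), of total weight `1/2 + 1/2` or `1`.

Sources: H. Duminil-Copin, S. Smirnov, *The connective constant of the honeycomb lattice equals
`√(2+√2)`*, Ann. of Math. 175 (2012) 1653–1665 (arXiv:1007.0575), §2 (domains as unions of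
mid-edges emanating from `V(Ω)`); the stub report `STUB-REPORT-subsequentialLimits.md` of this line
(§3, L6).
-/

noncomputable section

open scoped BigOperators
open Literature.Probability.LatticeModels Literature.Probability.RandomPlanarGeometry
open Literature.Probability.RandomPlanarGeometry.SAW
open Literature.Barriers.CriticalPhenomena

namespace Summit.CriticalPhenomena.SAWScalingLimit.Cruxes.QCIdentification.EightFifthsPrimitive

namespace Bulk

/-! ## The three ports of a hexagonal-lattice vertex -/

/-- The explicit neighbours `hexNbr v k` are neighbours in `ℍ`. [folklore] -/
private theorem adj_hexNbr (v : HexVertex) (j : Fin 3) : hexGraph.Adj v (hexNbr v j) := by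
  obtain ⟨x, s⟩ := v
  have key := HexKernel.hexGraph_adj_iff_of_snd_eq_zero_holds
  fin_cases s <;> fin_cases j
  · exact (key x x).2 (Or.inl rfl)
  · exact (key x (x - Pi.single 0 1)).2 (Or.inr (Or.inl rfl))
  · exact (key x (x - Pi.single 1 1)).2 (Or.inr (Or.inr rfl))
  · exact ((key x x).2 (Or.inl rfl)).symm
  · exact ((key (x + Pi.single 0 1) x).2 (Or.inr (Or.inl (by simp)))).symm
  · exact ((key (x + Pi.single 1 1) x).2 (Or.inr (Or.inr (by simp)))).symm

/-- The explicit neighbours are pairwise distinct. [folklore] -/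
private theorem hexNbr_ne (v : HexVertex) {i j : Fin 3} (hij : i ≠ j) :
    hexNbr v i ≠ hexNbr v j := by
  obtain ⟨x, s⟩ := v
  intro h
  apply hij
  fin_cases s <;> fin_cases i <;> fin_cases j <;> first
    | rfl
    | (exfalso
       simp [hexNbr, Prod.ext_iff, funext_iff, Fin.forall_fin_two] at h
       try omega)

/-- The port labelling `k ↦ hexNbr v k` is injective. [folklore] -/
private theorem hexNbr_injective (v : HexVertex) : Function.Injective (hexNbr v) := by
  intro i j h
  by_contra hij
  exact hexNbr_ne v hij h

/-- Every neighbour of a vertex is one of its three explicit neighbours. [folklore] -/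
private theorem exists_hexNbr_eq {v w : HexVertex} (h : hexGraph.Adj v w) :
    ∃ j : Fin 3, hexNbr v j = w := by
  obtain ⟨x, s⟩ := v
  obtain ⟨y, t⟩ := w
  have key := HexKernel.hexGraph_adj_iff_of_snd_eq_zero_holds
  have bip := HexKernel.not_hexGraph_adj_of_snd_eq_holds
  fin_cases s <;> fin_cases t
  · exact absurd h (bip _ _ rfl)
  · rcases (key x y).1 h with rfl | rfl | rfl
    · exact ⟨0, rfl⟩
    · exact ⟨1, rfl⟩
    · exact ⟨2, rfl⟩
  · rcases (key y x).1 h.symm with rfl | rfl | rfl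
    · exact ⟨0, rfl⟩
    · exact ⟨1, by simp [hexNbr]⟩
    · exact ⟨2, by simp [hexNbr]⟩
  · exact absurd h (bip _ _ rfl)

/-! ## Port weights and the finite set of mid-edges -/

/-- weight of the port k of v: 1/2 if the far endpoint is in Λ (interior mid-edge, seen from both ends),
else 1. -/
def portWeight (Λ : Finset HexVertex) (v : HexVertex) (k : Fin 3) : ℂ :=
  if hexNbr v k ∈ Λ then 1 / 2 else 1

/-- The mid-edges of the domain with vertex set `Λ` as a `Finset`: the image of the darts `(v, k)`,
`v ∈ Λ`, `k : Fin 3`, under `(v, k) ↦ {v, hexNbr v k}`. -/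
def portEdges (Λ : Finset HexVertex) : Finset (Sym2 HexVertex) :=
  (Λ ×ˢ (Finset.univ : Finset (Fin 3))).image fun p => s(p.1, hexNbr p.1 p.2)

/-- A port of a vertex of `Λ` is a mid-edge of `portEdges Λ`. [folklore] -/
theorem mk_hexNbr_mem_portEdges {Λ : Finset HexVertex} {v : HexVertex} (hv : v ∈ Λ) (k : Fin 3) :
    s(v, hexNbr v k) ∈ portEdges Λ :=
  Finset.mem_image.2 ⟨(v, k), Finset.mem_product.2 ⟨hv, Finset.mem_univ _⟩, rfl⟩

/-- An edge of `ℍ` at a vertex of `Λ` is a mid-edge of `portEdges Λ`. [folklore] -/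
theorem mk_mem_portEdges_of_adj {Λ : Finset HexVertex} {v w : HexVertex} (hv : v ∈ Λ)
    (h : hexGraph.Adj v w) : s(v, w) ∈ portEdges Λ := by
  obtain ⟨k, rfl⟩ := exists_hexNbr_eq h
  exact mk_hexNbr_mem_portEdges hv k

/-- `portEdges Λ` is exactly the set `hexDomainMidEdges Λ` of mid-edges with an endpoint in `Λ`.
[folklore] -/
theorem mem_portEdges_iff {Λ : Finset HexVertex} {e : Sym2 HexVertex} :
    e ∈ portEdges Λ ↔ e ∈ hexDomainMidEdges Λ := by
  constructor
  · intro h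
    obtain ⟨⟨v, k⟩, hp, rfl⟩ := Finset.mem_image.1 h
    have hv : v ∈ Λ := (Finset.mem_product.1 hp).1
    exact ⟨(SimpleGraph.mem_edgeSet hexGraph).2 (adj_hexNbr v k), v, Sym2.mem_mk_left _ _, hv⟩
  · rintro ⟨he, v, hve, hv⟩
    induction e using Sym2.ind with
    | h x y =>
      rw [SimpleGraph.mem_edgeSet] at he
      rcases Sym2.mem_iff.1 hve with h | h <;> subst h
      · exact mk_mem_portEdges_of_adj hv he
      · rw [Sym2.eq_swap]
        exact mk_mem_portEdges_of_adj hv he.symm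

/-- `hexDomainMidEdges Λ = ↑(portEdges Λ)`; in particular the mid-edge set of a finite domain is
finite and `finsum`s over it are `Finset.sum`s over `portEdges Λ`. [folklore] -/
theorem coe_portEdges (Λ : Finset HexVertex) :
    (portEdges Λ : Set (Sym2 HexVertex)) = hexDomainMidEdges Λ :=
  Set.ext fun _ => mem_portEdges_iff

/-- The `finsum` over the mid-edges of a finite domain is the `Finset.sum` over `portEdges`. [folklore] -/
theorem finsum_mem_hexDomainMidEdges_eq {M : Type*} [AddCommMonoid M] (Λ : Finset HexVertex)
    (g : Sym2 HexVertex → M) :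
    ∑ᶠ e ∈ hexDomainMidEdges Λ, g e = ∑ e ∈ portEdges Λ, g e := by
  rw [← coe_portEdges, finsum_mem_coe_finset]

/-! ## The fibre count: every mid-edge of the domain carries total port weight `1` -/

/-- The darts of `x` over the edge `{x, y}`: only the port towards `y`, of weight `1/2` or `1`
according as `y ∈ Λ` or not. [folklore] -/
theorem fibreWeight_left (Λ : Finset HexVertex) {x y : HexVertex} (hxy : hexGraph.Adj x y) :
    (∑ k : Fin 3, if s(x, hexNbr x k) = s(x, y) then portWeight Λ x k else 0) =
      if y ∈ Λ then 1 / 2 else 1 := by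
  obtain ⟨kx, hkx⟩ := exists_hexNbr_eq hxy
  rw [Fintype.sum_eq_single kx]
  · rw [if_pos (by rw [hkx]), portWeight, hkx]
  · intro k hk
    rw [if_neg]
    rw [Sym2.congr_right]
    intro h
    exact hk (hexNbr_injective x (h.trans hkx.symm))

/-- The darts of `y` over the edge `{x, y}`: only the port towards `x`, of weight `1/2` or `1`
according as `x ∈ Λ` or not. [folklore] -/
theorem fibreWeight_right (Λ : Finset HexVertex) {x y : HexVertex} (hxy : hexGraph.Adj x y) :
    (∑ k : Fin 3, if s(y, hexNbr y k) = s(x, y) then portWeight Λ y k else 0) =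
      if x ∈ Λ then 1 / 2 else 1 := by
  rw [show s(x, y) = s(y, x) from Sym2.eq_swap]
  exact fibreWeight_left Λ hxy.symm

/-- A vertex off the edge `{x, y}` has no dart over it. [folklore] -/
theorem fibreWeight_other (Λ : Finset HexVertex) {x y c : HexVertex} (hcx : c ≠ x) (hcy : c ≠ y) :
    (∑ k : Fin 3, if s(c, hexNbr c k) = s(x, y) then portWeight Λ c k else 0) = 0 := by
  refine Finset.sum_eq_zero fun k _ => if_neg fun h => ?_
  have hc : c ∈ s(x, y) := h ▸ Sym2.mem_mk_left c (hexNbr c k)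
  rcases Sym2.mem_iff.1 hc with h' | h'
  · exact hcx h'
  · exact hcy h'

/-- **Fibre count.** Every mid-edge `e` of the domain carries total port weight one:
`Σ_{v ∈ Λ} Σ_k [{v, hexNbr v k} = e] · portWeight Λ v k = 1` (two darts of weight `1/2` over an
interior mid-edge, one dart of weight `1` over a boundary mid-edge). [folklore] -/
theorem sum_fibreWeight_eq_one (Λ : Finset HexVertex) {e : Sym2 HexVertex}
    (he : e ∈ hexDomainMidEdges Λ) :
    (∑ v ∈ Λ, ∑ k : Fin 3, if s(v, hexNbr v k) = e then portWeight Λ v k else 0) = 1 := by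
  obtain ⟨he, w, hwe, hw⟩ := he
  induction e using Sym2.ind with
  | h x y =>
    rw [SimpleGraph.mem_edgeSet] at he
    have hne : x ≠ y := he.ne
    by_cases hx : x ∈ Λ <;> by_cases hy : y ∈ Λ
    · rw [Finset.sum_eq_add_of_mem x y hx hy hne
        (fun c _ hc => fibreWeight_other Λ hc.1 hc.2), fibreWeight_left Λ he,
        fibreWeight_right Λ he, if_pos hy, if_pos hx]
      norm_num
    · rw [Finset.sum_eq_single_of_mem x hx
        (fun c hc hcx => fibreWeight_other Λ hcx fun h : c = y => hy (h ▸ hc)),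
        fibreWeight_left Λ he, if_neg hy]
    · rw [Finset.sum_eq_single_of_mem y hy
        (fun c hc hcy => fibreWeight_other Λ (fun h : c = x => hx (h ▸ hc)) hcy),
        fibreWeight_right Λ he, if_neg hx]
    · exfalso
      rcases Sym2.mem_iff.1 hwe with rfl | rfl
      · exact hx hw
      · exact hy hw

/-! ## The regrouping identity and the averaged observable -/

/-- **Bulk-sum regrouping.** The sum of any function over the mid-edges of a hexagonal-lattice
domain equals the vertex-by-vertex sum over the three ports, an interior mid-edge being weighted `1/2`
from each of its two endpoints and a boundary mid-edge `1` from its endpoint in `Λ`: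
`Σᶠ_{e ∈ Ω(Λ)} g e = Σ_{v ∈ Λ} Σ_k portWeight Λ v k · g {v, hexNbr v k}`. [folklore] -/
theorem bulk_finsum_midEdges_eq : ∀ (Λ : Finset HexVertex) (g : Sym2 HexVertex → ℂ),
    ∑ᶠ e ∈ hexDomainMidEdges Λ, g e =
      ∑ v ∈ Λ, ∑ k : Fin 3, portWeight Λ v k * g s(v, hexNbr v k) := by
  intro Λ g
  rw [finsum_mem_hexDomainMidEdges_eq]
  -- every dart term is a sum over the mid-edges of the domain
  have h1 : ∀ v ∈ Λ, ∀ k : Fin 3, portWeight Λ v k * g s(v, hexNbr v k) =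
      ∑ e ∈ portEdges Λ, (if s(v, hexNbr v k) = e then portWeight Λ v k else 0) * g e := by
    intro v hv k
    simp_rw [ite_mul, zero_mul]
    rw [Finset.sum_ite_eq, if_pos (mk_hexNbr_mem_portEdges hv k)]
  symm
  calc ∑ v ∈ Λ, ∑ k : Fin 3, portWeight Λ v k * g s(v, hexNbr v k)
      = ∑ v ∈ Λ, ∑ k : Fin 3, ∑ e ∈ portEdges Λ,
          (if s(v, hexNbr v k) = e then portWeight Λ v k else 0) * g e :=
        Finset.sum_congr rfl fun v hv => Finset.sum_congr rfl fun k _ => h1 v hv k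
    _ = ∑ v ∈ Λ, ∑ e ∈ portEdges Λ, ∑ k : Fin 3,
          (if s(v, hexNbr v k) = e then portWeight Λ v k else 0) * g e :=
        Finset.sum_congr rfl fun v _ => Finset.sum_comm
    _ = ∑ e ∈ portEdges Λ, ∑ v ∈ Λ, ∑ k : Fin 3,
          (if s(v, hexNbr v k) = e then portWeight Λ v k else 0) * g e := Finset.sum_comm
    _ = ∑ e ∈ portEdges Λ,
          (∑ v ∈ Λ, ∑ k : Fin 3, if s(v, hexNbr v k) = e then portWeight Λ v k else 0) * g e := by
        refine Finset.sum_congr rfl fun e _ => ?_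
        rw [Finset.sum_mul]
        exact Finset.sum_congr rfl fun v _ => by rw [Finset.sum_mul]
    _ = ∑ e ∈ portEdges Λ, g e := by
        refine Finset.sum_congr rfl fun e he => ?_
        rw [sum_fibreWeight_eq_one Λ (mem_portEdges_iff.1 he), one_mul]

/-- **The averaged observable, vertex by vertex.**
`bulkAverage Λ a ψ δ = δ² Σ_{v ∈ Λ δ} Σ_k portWeight (Λ δ) v k · ψ(δ · m_{p_k}) · F_δ(p_k)`,
`p_k = {v, hexNbr v k}`. [folklore] -/
theorem bulk_bulkAverage_eq :
    ∀ (Λ : ℝ → Finset HexVertex) (a : ℝ → Sym2 HexVertex) (ψ : ℂ → ℂ) (δ : ℝ),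
    bulkAverage Λ a ψ δ = (δ : ℂ) ^ 2 * ∑ v ∈ Λ δ, ∑ k : Fin 3,
      portWeight (Λ δ) v k *
        (ψ ((δ : ℂ) * hexMidpoint s(v, hexNbr v k)) * Fobs (Λ δ) (a δ) s(v, hexNbr v k)) := by
  intro Λ a ψ δ
  rw [bulkAverage, bulk_finsum_midEdges_eq]

end Bulk

end Summit.CriticalPhenomena.SAWScalingLimit.Cruxes.QCIdentification.EightFifthsPrimitive

end
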